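import Literature.NumberTheory.LFunctions.RudnickSarnakNCellLimit
import HarnessLib

/-!
# Rudnick–Sarnak `n`-level correlations for `ζ`, XVIII: the pair integral in pair coordinates

Sibling file of `Literature/NumberTheory/LFunctions/RudnickSarnak.lean` (toward
`Literature.NumberTheory.LFunctions.rudnick_sarnak_unrestricted` at every level). The limit
`I_β(Φ)` of a cell (`RudnickSarnakN.pairInt`, an integral over the free coordinates
`{i ∉ U}` of the slice) is rewritten in the pair coordinates `v_p = ξ_∞(βp)`, `p ∈ P`:

  `I_β(Φ) = ∫_{v : P → ℝ} 1[v > 0] (Π_p v_p) Φ(Σ_p v_p (e_{βp} − e_p)) dv`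

(`RudnickSarnakN.pairInt_eq_integral_pairs`; Rudnick–Sarnak 1996, (3.74)). The map
`y ↦ v` is a coordinate bijection `P ≃ {i ∉ U}` (`RudnickSarnakN.idxOf`) followed by the
reflection of the special coordinate when `β p₀ = 0`, hence measure preserving.

## References

* Z. Rudnick, P. Sarnak, *Zeros of principal `L`-functions and random matrix theory*, Duke Math.
  J. 81 (1996), 269–322, (3.73)–(3.74).
-/

noncomputable section

open Complex Filter Set MeasureTheory Finset
open scoped Real Topology

namespace Literature.NumberTheory.LFunctions

namespace RudnickSarnakN

variable {k : ℕ}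

section Pattern

variable {D P : Finset (Fin (k + 1))} {β : ↥P ≃ ↥((Finset.univ \ D) \ P)}

/-! ## The free coordinate of a pair -/

variable (D P β) in
/-- The free coordinate carrying the pair `p`: the partner index `prt(p−1)` for an ordinary pair,
`p − 1` if `βp = 0`, `βp − 1` if `p = 0`. [folklore] -/
def idxOf (p : ↥P) : Fin k :=
  if h : ((p : Fin (k + 1)) ≠ 0 ∧ betaF D P β p ≠ 0) then prt D P β (((p : Fin (k + 1))).pred h.1)
  else if h0 : (p : Fin (k + 1)) ≠ 0 then ((p : Fin (k + 1))).pred h0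
  else (betaF D P β p).pred (betaF_ne_zero_of_zero_mem_P (β := β) (by rw [not_not] at h0; exact h0 ▸ p.2) p.2)

variable (D P β) in
/-- The sign of the pair coordinate: `−1` exactly for the special pair with `βp = 0`. [folklore] -/
def sgnP (p : ↥P) : ℝ := if betaF D P β p = 0 then -1 else 1

/-- `p − 1 ∈ A` for an ordinary pair. [folklore] -/
theorem pred_mem_Aidx {p : ↥P} (h : (p : Fin (k + 1)) ≠ 0 ∧ betaF D P β p ≠ 0) :
    ((p : Fin (k + 1))).pred h.1 ∈ Aidx D P β := by
  rw [Aidx, Finset.mem_filter, Fin.succ_pred]; exact ⟨Finset.mem_univ _, p.2, h.2⟩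

/-- `idxOf p ∉ U` (`P ⊆ Dᶜ`). [folklore] -/
theorem idxOf_not_mem_Uidx (hP : P ⊆ Finset.univ \ D) (p : ↥P) : idxOf D P β p ∉ Uidx D P β := by
  unfold idxOf
  split_ifs with h h0
  · exact prt_not_mem_Uidx (pred_mem_Aidx h)
  · refine not_mem_Uidx_of_mem_Zidx ?_
    have hb : betaF D P β p = 0 := by by_contra hb; exact h ⟨h0, hb⟩
    rw [Zidx_eq_of_betaF_eq_zero hP p.2 hb h0]; exact Finset.mem_singleton_self _
  · refine not_mem_Uidx_of_mem_Zidx ?_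
    rw [not_not] at h0
    have hPm : (0 : Fin (k + 1)) ∈ P := h0 ▸ p.2
    rw [Zidx_eq_of_zero_mem_P hPm]
    have : betaF D P β p = betaF D P β 0 := by rw [h0]
    simp only [this, Finset.mem_singleton]

/-- **The pair coordinate**: `ξ_∞(ext y)(βp) = sgn_p · y_{idxOf p}` (`P ⊆ Dᶜ`). [folklore] -/
theorem xiInf_extOff_betaF (hP : P ⊆ Finset.univ \ D) (y : {i // i ∉ Uidx D P β} → ℝ) (p : ↥P) :
    xiInf D P β (extOff D P β y) (betaF D P β p) = sgnP D P β p * y ⟨idxOf D P β p, idxOf_not_mem_Uidx hP p⟩ := by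
  have key : ∀ (i : Fin k) (hi : i ∉ Uidx D P β) (hi' : idxOf D P β p = i),
      y ⟨idxOf D P β p, idxOf_not_mem_Uidx hP p⟩ = y ⟨i, hi⟩ := by
    intro i hi hi'; congr 1; exact Subtype.ext hi'
  unfold sgnP
  by_cases h : ((p : Fin (k + 1)) ≠ 0 ∧ betaF D P β p ≠ 0)
  · -- ordinary pair: `βp = (prt a) + 1`, value `y (prt a)`
    have ha := pred_mem_Aidx h
    have hidx : idxOf D P β p = prt D P β (((p : Fin (k + 1))).pred h.1) := by unfold idxOf; rw [dif_pos h]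
    have hU := prt_not_mem_Uidx (β := β) ha
    rw [if_neg h.2, one_mul, key _ hU hidx]
    have e1 : betaF D P β p = (prt D P β (((p : Fin (k + 1))).pred h.1)).succ := by rw [prt_succ D P β ha, Fin.succ_pred]
    conv_lhs => rw [e1]
    unfold xiInf
    rw [Fin.cons_succ, if_neg (prt_not_mem_Didx ha), if_neg (prt_not_mem_Aidx ha)]
    unfold extOff; rw [dif_neg hU]
  · by_cases h0 : (p : Fin (k + 1)) ≠ 0
    · -- `βp = 0`: value `−z = −y (p − 1)`
      have hb : betaF D P β p = 0 := by by_contra hb; exact h ⟨h0, hb⟩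
      have hidx : idxOf D P β p = ((p : Fin (k + 1))).pred h0 := by unfold idxOf; rw [dif_neg h, dif_pos h0]
      have hZ := Zidx_eq_of_betaF_eq_zero hP p.2 hb h0
      have hU : ((p : Fin (k + 1))).pred h0 ∉ Uidx D P β := not_mem_Uidx_of_mem_Zidx (by rw [hZ]; exact Finset.mem_singleton_self _)
      rw [if_pos hb, hb, key _ hU hidx]
      unfold xiInf
      rw [Fin.cons_zero]
      unfold zcoord
      rw [hZ, Finset.sum_singleton]
      unfold extOff; rw [dif_neg hU]; ring
    · -- `p = 0`: value `y (βp − 1)`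
      rw [not_not] at h0
      have hPm : (0 : Fin (k + 1)) ∈ P := h0 ▸ p.2
      have hbne : betaF D P β p ≠ 0 := betaF_ne_zero_of_zero_mem_P hPm p.2
      have hidx : idxOf D P β p = (betaF D P β p).pred hbne := by
        unfold idxOf; rw [dif_neg h, dif_neg (not_not.2 h0)]
      have hb0 : betaF D P β p = betaF D P β 0 := by rw [h0]
      have hZ := Zidx_eq_of_zero_mem_P (β := β) hPm
      have hU : (betaF D P β p).pred hbne ∉ Uidx D P β :=
        not_mem_Uidx_of_mem_Zidx (by rw [hZ, Finset.mem_singleton]; simp only [hb0])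
      rw [if_neg hbne, one_mul, key _ hU hidx]
      have e1 : betaF D P β p = ((betaF D P β p).pred hbne).succ := by rw [Fin.succ_pred]
      have hz : (betaF D P β p).pred hbne ∈ Zidx D P β := by rw [hZ, Finset.mem_singleton]; simp only [hb0]
      obtain ⟨hD, hA, -⟩ := (mem_Zidx_iff _).1 hz
      conv_lhs => rw [e1]
      unfold xiInf
      rw [Fin.cons_succ, if_neg hD, if_neg hA]
      unfold extOff; rw [dif_neg hU]

/-- The complementary value: `ξ_∞(ext y)(p) = −sgn_p · y_{idxOf p}` (`P ⊆ Dᶜ`). [folklore] -/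
theorem xiInf_extOff_self (hP : P ⊆ Finset.univ \ D) (y : {i // i ∉ Uidx D P β} → ℝ) (p : ↥P) :
    xiInf D P β (extOff D P β y) p = -(sgnP D P β p * y ⟨idxOf D P β p, idxOf_not_mem_Uidx hP p⟩) := by
  have key : ∀ (i : Fin k) (hi : i ∉ Uidx D P β) (hi' : idxOf D P β p = i),
      y ⟨idxOf D P β p, idxOf_not_mem_Uidx hP p⟩ = y ⟨i, hi⟩ := by
    intro i hi hi'; congr 1; exact Subtype.ext hi'
  unfold sgnP
  by_cases h : ((p : Fin (k + 1)) ≠ 0 ∧ betaF D P β p ≠ 0)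
  · have ha := pred_mem_Aidx h
    have hidx : idxOf D P β p = prt D P β (((p : Fin (k + 1))).pred h.1) := by unfold idxOf; rw [dif_pos h]
    have hU := prt_not_mem_Uidx (β := β) ha
    rw [if_neg h.2, one_mul, key _ hU hidx]
    have e1 : (p : Fin (k + 1)) = (((p : Fin (k + 1))).pred h.1).succ := by rw [Fin.succ_pred]
    conv_lhs => rw [e1]
    unfold xiInf
    rw [Fin.cons_succ, if_neg (Finset.disjoint_right.1 (disjoint_Didx_Aidx (β := β) hP) ha), if_pos ha]
    unfold extOff; rw [dif_neg hU]
  · by_cases h0 : (p : Fin (k + 1)) ≠ 0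
    · have hb : betaF D P β p = 0 := by by_contra hb; exact h ⟨h0, hb⟩
      have hidx : idxOf D P β p = ((p : Fin (k + 1))).pred h0 := by unfold idxOf; rw [dif_neg h, dif_pos h0]
      have hZ := Zidx_eq_of_betaF_eq_zero hP p.2 hb h0
      have hz : ((p : Fin (k + 1))).pred h0 ∈ Zidx D P β := by rw [hZ]; exact Finset.mem_singleton_self _
      have hU : ((p : Fin (k + 1))).pred h0 ∉ Uidx D P β := not_mem_Uidx_of_mem_Zidx hz
      obtain ⟨hD, hA, -⟩ := (mem_Zidx_iff _).1 hz
      rw [if_pos hb, key _ hU hidx]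
      have e1 : (p : Fin (k + 1)) = (((p : Fin (k + 1))).pred h0).succ := by rw [Fin.succ_pred]
      conv_lhs => rw [e1]
      unfold xiInf
      rw [Fin.cons_succ, if_neg hD, if_neg hA]
      unfold extOff; rw [dif_neg hU]; ring
    · rw [not_not] at h0
      have hPm : (0 : Fin (k + 1)) ∈ P := h0 ▸ p.2
      have hbne : betaF D P β p ≠ 0 := betaF_ne_zero_of_zero_mem_P hPm p.2
      have hidx : idxOf D P β p = (betaF D P β p).pred hbne := by
        unfold idxOf; rw [dif_neg h, dif_neg (not_not.2 h0)]
      have hb0 : betaF D P β p = betaF D P β 0 := by rw [h0]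
      have hZ := Zidx_eq_of_zero_mem_P (β := β) hPm
      have hz : (betaF D P β p).pred hbne ∈ Zidx D P β := by rw [hZ, Finset.mem_singleton]; simp only [hb0]
      have hU : (betaF D P β p).pred hbne ∉ Uidx D P β := not_mem_Uidx_of_mem_Zidx hz
      rw [if_neg hbne, one_mul, key _ hU hidx]
      conv_lhs => rw [h0]
      unfold xiInf
      rw [Fin.cons_zero]
      unfold zcoord
      rw [show Zidx D P β = {(betaF D P β p).pred hbne} by rw [hZ]; congr 1; simp only [hb0], Finset.sum_singleton]
      unfold extOff; rw [dif_neg hU]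

/-- `ξ_∞(ext y)` vanishes on `D` (`P ⊆ Dᶜ`). [folklore] -/
theorem xiInf_extOff_of_mem_D (hP : P ⊆ Finset.univ \ D) (y : {i // i ∉ Uidx D P β} → ℝ) {j : Fin (k + 1)} (hj : j ∈ D) :
    xiInf D P β (extOff D P β y) j = 0 := by
  unfold xiInf
  refine Fin.cases ?_ (fun i hj ↦ ?_) j hj
  · intro h0
    rw [Fin.cons_zero, neg_eq_zero]
    unfold zcoord; rw [Zidx_eq_empty hP h0, Finset.sum_empty]
  · rw [Fin.cons_succ, if_pos (by rw [Didx, Finset.mem_filter]; exact ⟨Finset.mem_univ _, hj⟩)]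

/-! ## The bijection `P ≃ {i ∉ U}` -/

/-- `βp ∉ P`. [folklore] -/
theorem betaF_not_mem_P (p : ↥P) : betaF D P β p ∉ P := (Finset.mem_sdiff.1 (betaF_mem D P β p.2)).2

/-- `idxOf` is injective (`P ⊆ Dᶜ`). [folklore] -/
theorem idxOf_injective (hP : P ⊆ Finset.univ \ D) : Function.Injective (idxOf D P β) := by
  intro p q hpq
  -- classes: ordinary ↦ `Bidx`, special ↦ `Zidx`
  have hB : ∀ r : ↥P, ∀ h : ((r : Fin (k + 1)) ≠ 0 ∧ betaF D P β r ≠ 0), idxOf D P β r ∈ Bidx D P β := by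
    intro r h
    unfold idxOf; rw [dif_pos h]
    exact Finset.mem_image_of_mem _ (pred_mem_Aidx h)
  have hZ : ∀ r : ↥P, ¬ ((r : Fin (k + 1)) ≠ 0 ∧ betaF D P β r ≠ 0) → idxOf D P β r ∈ Zidx D P β := by
    intro r h
    unfold idxOf; rw [dif_neg h]
    by_cases h0 : (r : Fin (k + 1)) ≠ 0
    · rw [dif_pos h0]
      have hb : betaF D P β r = 0 := by by_contra hb; exact h ⟨h0, hb⟩
      rw [Zidx_eq_of_betaF_eq_zero hP r.2 hb h0]; exact Finset.mem_singleton_self _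
    · rw [dif_neg h0]
      rw [not_not] at h0
      have hPm : (0 : Fin (k + 1)) ∈ P := h0 ▸ r.2
      rw [Zidx_eq_of_zero_mem_P hPm, Finset.mem_singleton]
      congr 1
      · rw [h0]
  have hBZ : ∀ i, i ∈ Bidx D P β → i ∉ Zidx D P β := fun i hi hz ↦ ((mem_Zidx_iff i).1 hz).2.2 hi
  by_cases hp : ((p : Fin (k + 1)) ≠ 0 ∧ betaF D P β p ≠ 0)
  · by_cases hq : ((q : Fin (k + 1)) ≠ 0 ∧ betaF D P β q ≠ 0)
    · -- both ordinary
      have e : prt D P β (((p : Fin (k + 1))).pred hp.1) = prt D P β (((q : Fin (k + 1))).pred hq.1) := by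
        have h1 : idxOf D P β p = prt D P β (((p : Fin (k + 1))).pred hp.1) := by unfold idxOf; rw [dif_pos hp]
        have h2 : idxOf D P β q = prt D P β (((q : Fin (k + 1))).pred hq.1) := by unfold idxOf; rw [dif_pos hq]
        rw [← h1, ← h2, hpq]
      have := prt_injOn (Finset.mem_coe.2 (pred_mem_Aidx hp)) (Finset.mem_coe.2 (pred_mem_Aidx hq)) e
      exact Subtype.ext (Fin.pred_inj.1 this)
    · have h1 := hB p hp
      rw [hpq] at h1
      exact absurd (hZ q hq) (hBZ _ h1)
  · by_cases hq : ((q : Fin (k + 1)) ≠ 0 ∧ betaF D P β q ≠ 0)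
    · have h1 := hB q hq
      rw [← hpq] at h1
      exact absurd (hZ p hp) (hBZ _ h1)
    · -- both special
      rw [not_and_or, not_not, not_not] at hp hq
      rcases hp with hp0 | hpb <;> rcases hq with hq0 | hqb
      · exact Subtype.ext (hp0.trans hq0.symm)
      · exact absurd (hqb ▸ betaF_not_mem_P q) (not_not.2 (hp0 ▸ p.2))
      · exact absurd (hpb ▸ betaF_not_mem_P p) (not_not.2 (hq0 ▸ q.2))
      · exact Subtype.ext (betaF_injOn D P β (Finset.mem_coe.2 p.2) (Finset.mem_coe.2 q.2) (hpb.trans hqb.symm))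

/-- `|P| = |{i ∉ U}|` (`P ⊆ Dᶜ`). [folklore] -/
theorem card_P_eq (hP : P ⊆ Finset.univ \ D) : Fintype.card ↥P = Fintype.card {i // i ∉ Uidx D P β} := by
  have hU : (Uidx D P β).card + 1 = D.card + P.card := card_Uidx (β := β) hP
  have hPQ : P.card = ((Finset.univ \ D) \ P).card := by
    have := Fintype.card_congr β; simp only [Fintype.card_coe] at this; exact this
  have hDPQ : D.card + (P.card + ((Finset.univ \ D) \ P).card) = k + 1 := by
    rw [← Finset.card_union_of_disjoint Finset.disjoint_sdiff, Finset.union_sdiff_of_subset hP,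
      ← Finset.card_union_of_disjoint Finset.disjoint_sdiff, Finset.union_sdiff_of_subset (Finset.subset_univ D),
      Finset.card_univ, Fintype.card_fin]
  rw [Fintype.card_subtype_compl, Fintype.card_coe, Fintype.card_coe, Fintype.card_fin]
  omega

/-- **The bijection `P ≃ {i ∉ U}`.** [folklore] -/
def ePU (hP : P ⊆ Finset.univ \ D) : ↥P ≃ {i // i ∉ Uidx D P β} :=
  Equiv.ofBijective (fun p ↦ ⟨idxOf D P β p, idxOf_not_mem_Uidx hP p⟩)
    ((Fintype.bijective_iff_injective_and_card _).2
      ⟨fun _ _ h ↦ idxOf_injective hP (congrArg Subtype.val h), card_P_eq hP⟩)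

/-- `ePU p = ⟨idxOf p, _⟩`. [folklore] -/
theorem ePU_apply (hP : P ⊆ Finset.univ \ D) (p : ↥P) : (ePU (β := β) hP p : Fin k) = idxOf D P β p := rfl

/-! ## The slice point in pair coordinates -/

variable (D P β) in
/-- The pair coordinates `v_p(y) = ξ_∞(ext y)(βp)`. [folklore] -/
def pairCoord (y : {i // i ∉ Uidx D P β} → ℝ) (p : ↥P) : ℝ := xiInf D P β (extOff D P β y) (betaF D P β p)

variable (D P β) in
/-- The pair vector `e_{βp} − e_p`. [cite: RudnickSarnak1996, (3.10)] -/
def dvec (p : ↥P) : Fin (k + 1) → ℝ := Pi.single (betaF D P β p) 1 - Pi.single (p : Fin (k + 1)) 1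

/-- **`ξ_∞(ext y) = Σ_p v_p (e_{βp} − e_p)`** (`P ⊆ Dᶜ`). [cite: RudnickSarnak1996, (3.73)–(3.74)] -/
theorem xiInf_extOff_eq_sum (hP : P ⊆ Finset.univ \ D) (y : {i // i ∉ Uidx D P β} → ℝ) :
    xiInf D P β (extOff D P β y) = ∑ p : ↥P, pairCoord D P β y p • dvec D P β p := by
  classical
  funext j
  have hPQ : ∀ r : ↥P, betaF D P β r ∉ P := betaF_not_mem_P
  rw [Finset.sum_apply]
  simp only [dvec, pairCoord, Pi.smul_apply, Pi.sub_apply, Pi.single_apply, smul_eq_mul, mul_sub, mul_ite, mul_one, mul_zero,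
    Finset.sum_sub_distrib]
  by_cases hjD : j ∈ D
  · rw [xiInf_extOff_of_mem_D hP y hjD]
    have hjS : j ∉ Finset.univ \ D := fun h ↦ (Finset.mem_sdiff.1 h).2 hjD
    rw [Finset.sum_eq_zero fun (p : ↥P) _ ↦ if_neg fun h : j = betaF D P β p ↦ hjS (h ▸ (Finset.mem_sdiff.1 (betaF_mem D P β p.2)).1),
      Finset.sum_eq_zero fun (p : ↥P) _ ↦ if_neg fun h : j = (p : Fin (k + 1)) ↦ hjS (h ▸ hP p.2), sub_zero]
  · by_cases hjP : j ∈ P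
    · -- `j = p₁ ∈ P`
      set p₁ : ↥P := ⟨j, hjP⟩
      rw [Finset.sum_eq_zero fun (p : ↥P) _ ↦ if_neg fun h : j = betaF D P β p ↦ hPQ p (h ▸ hjP)]
      rw [Finset.sum_eq_single p₁ (fun (p : ↥P) _ hp ↦ if_neg fun h : j = (p : Fin (k + 1)) ↦ hp (Subtype.ext h.symm))
        (fun h ↦ absurd (Finset.mem_univ _) h), if_pos rfl, zero_sub]
      have h1 := xiInf_extOff_self hP y p₁
      have h2 := xiInf_extOff_betaF hP y p₁
      rw [h2]; exact h1
    · -- `j = β p₁ ∈ Q`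
      have hjQ : j ∈ (Finset.univ \ D) \ P := Finset.mem_sdiff.2 ⟨Finset.mem_sdiff.2 ⟨Finset.mem_univ _, hjD⟩, hjP⟩
      obtain ⟨p₁, hp₁, hb⟩ := exists_betaF_eq D P β hjQ
      set q₁ : ↥P := ⟨p₁, hp₁⟩
      rw [Finset.sum_eq_zero fun (p : ↥P) _ ↦ if_neg fun h : j = (p : Fin (k + 1)) ↦ hjP (h ▸ p.2), sub_zero]
      rw [Finset.sum_eq_single q₁ (fun (p : ↥P) _ hp ↦ if_neg fun h : j = betaF D P β p ↦ hp (Subtype.ext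
          (betaF_injOn D P β (Finset.mem_coe.2 p.2) (Finset.mem_coe.2 hp₁) (h.symm.trans hb.symm))))
        (fun h ↦ absurd (Finset.mem_univ _) h)]
      rw [if_pos hb.symm, ← hb]

/-- **`V_∞(ext y) = Π_p v_p`** (`P ⊆ Dᶜ`). [folklore] -/
theorem Vinf_extOff_eq_prod (hP : P ⊆ Finset.univ \ D) (y : {i // i ∉ Uidx D P β} → ℝ) :
    Vinf D P β (extOff D P β y) = ∏ p : ↥P, pairCoord D P β y p := by
  classical
  have hcoe : ∏ p : ↥P, pairCoord D P β y p = ∏ p ∈ P, xiInf D P β (extOff D P β y) (betaF D P β p) := by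
    unfold pairCoord; rw [← Finset.prod_coe_sort P]
  rw [hcoe, prod_P_split (β := β)]
  have hA : ∏ a ∈ Aidx D P β, xiInf D P β (extOff D P β y) (betaF D P β a.succ) = ∏ a ∈ Aidx D P β, extOff D P β y (prt D P β a) := by
    refine Finset.prod_congr rfl fun a ha ↦ ?_
    rw [← prt_succ D P β ha]
    unfold xiInf
    rw [Fin.cons_succ, if_neg (prt_not_mem_Didx ha), if_neg (prt_not_mem_Aidx ha)]
  rw [hA]
  unfold Vinf
  congr 1
  rcases zero_mem_cases hP with ⟨hD, -, -⟩ | ⟨hD, hPm, -⟩ | ⟨hD, hPn, hQ⟩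
  · rw [if_pos hD, filter_special_eq_empty hP hD, Finset.prod_empty]
  · rw [if_neg hD, if_pos hPm, filter_special_eq_of_zero_mem_P hPm, Finset.prod_singleton]
    have hb0 := betaF_ne_zero_of_zero_mem_P (β := β) hPm hPm
    have hz : (betaF D P β 0).pred hb0 ∈ Zidx D P β := by rw [Zidx_eq_of_zero_mem_P hPm]; exact Finset.mem_singleton_self _
    obtain ⟨hD', hA', -⟩ := (mem_Zidx_iff _).1 hz
    conv_rhs => rw [show betaF D P β 0 = ((betaF D P β 0).pred hb0).succ by rw [Fin.succ_pred]]
    unfold xiInf zcoord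
    rw [Fin.cons_succ, if_neg hD', if_neg hA', Zidx_eq_of_zero_mem_P hPm, Finset.sum_singleton]
  · obtain ⟨p₀, hp₀, hb⟩ := exists_betaF_eq D P β hQ
    rw [if_neg hD, if_neg hPn, filter_special_eq_of_betaF_eq_zero hp₀ hb, Finset.prod_singleton, hb]
    unfold xiInf
    rw [Fin.cons_zero]

/-- **The cell in pair coordinates**: `posSide(ξ_∞(ext y)) = P ↔ ∀ p, v_p > 0` (`P ⊆ Dᶜ`). [folklore] -/
theorem cell_iff_pairCoord_pos (hP : P ⊆ Finset.univ \ D) (y : {i // i ∉ Uidx D P β} → ℝ) :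
    posSide (xiInf D P β (extOff D P β y)) (Finset.univ \ D) = P ↔ ∀ p : ↥P, 0 < pairCoord D P β y p := by
  unfold posSide pairCoord
  constructor
  · intro h p
    have hq := betaF_mem D P β p.2
    obtain ⟨hqS, hqP⟩ := Finset.mem_sdiff.1 hq
    have : betaF D P β p ∉ (Finset.univ \ D).filter (fun j ↦ xiInf D P β (extOff D P β y) j ≤ 0) := by rw [h]; exact hqP
    rw [Finset.mem_filter, not_and] at this
    exact not_le.1 (this hqS)
  · intro h
    ext j
    rw [Finset.mem_filter]
    constructor
    · rintro ⟨hjS, hle⟩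
      by_contra hjP
      obtain ⟨p₁, hp₁, hb⟩ := exists_betaF_eq D P β (Finset.mem_sdiff.2 ⟨hjS, hjP⟩)
      have := h ⟨p₁, hp₁⟩
      rw [hb] at this
      linarith
    · intro hjP
      refine ⟨hP hjP, ?_⟩
      have h1 := xiInf_extOff_self hP y ⟨j, hjP⟩
      have h2 := xiInf_extOff_betaF hP y ⟨j, hjP⟩
      have h3 := h ⟨j, hjP⟩
      simp only at h1 h2
      rw [h2] at h3
      rw [h1]; linarith

/-! ## The change of variables `y ↦ v` -/

/-- The coordinate reflections `v_p ↦ sgn_p v_p` are measure preserving. [folklore] -/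
theorem measurePreserving_sgnP_mul (p : ↥P) : MeasurePreserving (fun x : ℝ ↦ sgnP D P β p * x) := by
  unfold sgnP
  split_ifs
  · rw [show (fun x : ℝ ↦ (-1 : ℝ) * x) = Neg.neg from funext fun x ↦ neg_one_mul x]
    exact Measure.measurePreserving_neg _
  · rw [show (fun x : ℝ ↦ (1 : ℝ) * x) = id from funext fun x ↦ one_mul x]
    exact MeasurePreserving.id _

variable (D P β) in
/-- The reflection of the special coordinate, as a measurable equivalence. [folklore] -/
def flipP : (↥P → ℝ) ≃ᵐ (↥P → ℝ) where
  toFun g p := sgnP D P β p * g p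
  invFun g p := sgnP D P β p * g p
  left_inv g := by
    funext p
    have : sgnP D P β p * sgnP D P β p = 1 := by unfold sgnP; split_ifs <;> norm_num
    simp only; rw [← mul_assoc, this, one_mul]
  right_inv g := by
    funext p
    have : sgnP D P β p * sgnP D P β p = 1 := by unfold sgnP; split_ifs <;> norm_num
    simp only; rw [← mul_assoc, this, one_mul]
  measurable_toFun := measurable_pi_iff.2 fun p ↦ (measurable_pi_apply p).const_mul _
  measurable_invFun := measurable_pi_iff.2 fun p ↦ (measurable_pi_apply p).const_mul _

/-- `flipP` is measure preserving. [folklore] -/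
theorem measurePreserving_flipP : MeasurePreserving (flipP D P β) := by
  have h := volume_preserving_pi (fun p : ↥P ↦ measurePreserving_sgnP_mul (D := D) (β := β) p)
  exact h

/-- **Change of variables**: `∫ F(v(y)) dy = ∫ F(v) dv` (`P ⊆ Dᶜ`). [folklore] -/
theorem integral_pairCoord (hP : P ⊆ Finset.univ \ D) (F : (↥P → ℝ) → ℂ) :
    ∫ y : {i // i ∉ Uidx D P β} → ℝ, F (pairCoord D P β y) = ∫ v : ↥P → ℝ, F v := by
  -- the integrand in terms of `y ∘ ePU` and the signs
  have h0 : ∀ y : {i // i ∉ Uidx D P β} → ℝ, pairCoord D P β y = fun p ↦ sgnP D P β p * y (ePU (β := β) hP p) :=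
    fun y ↦ funext fun p ↦ xiInf_extOff_betaF hP y p
  simp_rw [h0]
  -- reindex
  have hmp := volume_measurePreserving_piCongrLeft (fun _ : {i // i ∉ Uidx D P β} ↦ ℝ) (ePU (β := β) hP)
  have hA := hmp.integral_comp (MeasurableEquiv.measurableEmbedding _)
    (fun y : {i // i ∉ Uidx D P β} → ℝ ↦ F (fun p ↦ sgnP D P β p * y (ePU (β := β) hP p)))
  rw [← hA]
  have happ : ∀ (g : ↥P → ℝ) (p : ↥P),
      (MeasurableEquiv.piCongrLeft (fun _ : {i // i ∉ Uidx D P β} ↦ ℝ) (ePU (β := β) hP)) g (ePU (β := β) hP p) = g p :=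
    fun g p ↦ MeasurableEquiv.piCongrLeft_apply_apply (β := fun _ ↦ ℝ) _ g p
  simp_rw [happ]
  -- reflect
  have hB := (measurePreserving_flipP (D := D) (P := P) (β := β)).integral_comp (flipP D P β).measurableEmbedding F
  exact hB

/-! ## The pair integral in pair coordinates -/

open scoped Classical in
/-- The orthant weight `1[v > 0] Π_p v_p`. [folklore] -/
def orthProd {ι : Type*} [Fintype ι] (v : ι → ℝ) : ℝ := if ∀ i, 0 < v i then ∏ i, v i else 0

/-- **The pair integral in pair coordinates** (`P ⊆ Dᶜ`):
`I_β(Φ) = ∫_{v : P → ℝ} 1[v > 0] (Π_p v_p) Φ(Σ_p v_p (e_{βp} − e_p)) dv`. [cite: RudnickSarnak1996, (3.74)] -/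
theorem pairInt_eq_integral_pairs (hP : P ⊆ Finset.univ \ D) (Φ : (Fin (k + 1) → ℝ) → ℂ) :
    pairInt D P β Φ = ∫ v : ↥P → ℝ, ((orthProd v : ℝ) : ℂ) * Φ (∑ p, v p • dvec D P β p) := by
  classical
  unfold pairInt
  rw [← integral_pairCoord hP (fun v ↦ ((orthProd v : ℝ) : ℂ) * Φ (∑ p, v p • dvec D P β p))]
  refine integral_congr_ae (Eventually.of_forall fun y ↦ ?_)
  simp only
  rw [← xiInf_extOff_eq_sum hP y, Vinf_extOff_eq_prod hP y, mul_comm]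
  congr 2
  unfold cellInd orthProd
  by_cases h : ∀ p : ↥P, 0 < pairCoord D P β y p
  · rw [if_pos ((cell_iff_pairCoord_pos hP y).2 h), if_pos h, one_mul]
  · rw [if_neg (fun h' ↦ h ((cell_iff_pairCoord_pos hP y).1 h')), if_neg h, zero_mul]

end Pattern

end RudnickSarnakN

end Literature.NumberTheory.LFunctions

end
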